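import Summits.ValiantsHypothesis.ValiantsHypothesis.Theorems.ShallowShadowsShadowFormulaTransferOneProductShadow
import HarnessLib

/-!
# Crux `ShallowShadows.ShadowFormulaTransfer` (stmt-ValiantsHypothesis-17124), line `Sketch` —
# the registered stub `stub_twoProductDeadCase` (first bite `T = 2`, the DEAD case)

The SHADOW of `g ∈ ℂ[x_i : i ∈ ι]` is the monotone Boolean function
`B g : a ↦ [∃ m ∈ supp g, supp m ⊆ {i | a i}]`; with the face restriction
`ρ_a = bind₁ (l ↦ if a l then X l else 0)` (an algebra hom) one has `B g a ↔ ρ_a g ≠ 0`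
(`shadow_iff_restrictFace_ne_zero`). Here `g = α Π_π U_π + β Π_π V_π` is a combination of TWO
products of `D` affine forms `U_π = affVal (φ π)`, `V_π = affVal (ψ π)` over `ℂ`, under the
DEAD-CASE hypothesis: every false point `b` of the shadow (`ρ_b g = 0`) kills a form,
`ρ_b U_π = 0` or `ρ_b V_π = 0` for some `π`.

Claim: `formulaSizeOver monotoneBasis (B g) ≤ 16 (D+1)² (N+1)`, `N = #ι`.

Proof. If `β = 0` (resp. `α = 0`) then `g` is ONE scaled product and the one-product bound
`4 (D+1) (N+1)` (`formulaSizeOver_shadow_smul_prod_affVal_le`, the CNF protocol) applies. If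
`α ≠ 0 ≠ β`, the hypothesis upgrades, over the DOMAIN `ℂ[x]`, to: every false point kills BOTH
products — if `ρ_b U_π = 0` then `0 = ρ_b g = β Π ρ_b V` forces some `ρ_b V_κ = 0`, and
symmetrically. Hence `B g = B(Π U) ∨ B(Π V)` EXACTLY (`shadow_twoProd_iff_of_dead`; the direction
`⇒` is `ρ_a g = α Πρ_a U + β Πρ_a V`), and each `B(Π ·)` is the monotone CNF
`∧_{π : const = 0} ∨_{j : coeff ≠ 0} x_j` (`restrictFace_affVal_ne_zero_iff`). The monotone
Karchmer–Wigderson game of an `∨` of two CNFs has the folklore protocol (Karchmer–Wigderson 1990,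
§2): Alice says which CNF is true at `a` (1 bit, `KWTree.solvesMono_alice_or`), then the CNF
protocol (`exists_kwTree_cnf`: Bob names a clause violated at `b`, `⌈log₂ D⌉` bits; Alice a
variable of it that is `1` at `a`, `⌈log₂ N⌉` bits). By protocol ⟹ formula
(`KWTree.formulaSizeOver_le_two_pow_depth`) the size is at most
`2 · 2^{⌈log₂ D⌉} · 2^{⌈log₂ N⌉} ≤ 2 (2D+1) (2N+1) ≤ 16 (D+1)² (N+1)` (`RazBlocks.two_pow_clog_le`).
A shadow not taking both values (e.g. `ι` empty) has the junk value `0`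
(`formulaSizeOver_monotoneBasis_eq_zero_of_not_nonconst`).

Main results: `formulaSizeOver_shadow_twoProd_le_of_dead` (any `decide`-spelling `B` of the
shadow) and the registered signature `stub_twoProductDeadCase`.

## References

* [KarchmerWigderson1990] M. Karchmer, A. Wigderson, *Monotone circuits for connectivity require
  super-logarithmic depth*, SIAM J. Discrete Math. 3 (1990) 255–265, §2 (the monotone game
  `R_f^m`; protocols for `f ∨ g`, `f ∧ g`).
* [JuknaBFC2012] S. Jukna, *Boolean Function Complexity* (2012), §3.3.
-/

-- Sub = Summit single-conjunct layout: the duplicated namespace component is mandated by the tree.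
set_option linter.dupNamespace false

noncomputable section

namespace Summit.ValiantsHypothesis.ValiantsHypothesis.Theorems.ShallowShadowsShadowFormulaTransfer

open Literature.Computability.AlgebraicComplexity Literature.Computability.Complexity
open Literature.Computability.AlgebraicComplexity.DepthThreeChasm
open MvPolynomial

/-! ### Two terms over a domain -/

/-- Over a semiring without zero divisors: if `α, β ≠ 0` and the vanishing of `α u + β v` forces
`u = 0` or `v = 0`, then it forces both, i.e. `α u + β v ≠ 0 ↔ u ≠ 0 ∨ v ≠ 0`. [folklore] -/
theorem add_mul_ne_zero_iff_of_dead {R : Type*} [Semiring R] [NoZeroDivisors R] {α β u v : R}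
    (hα : α ≠ 0) (hβ : β ≠ 0) (H : α * u + β * v = 0 → u = 0 ∨ v = 0) :
    α * u + β * v ≠ 0 ↔ u ≠ 0 ∨ v ≠ 0 := by
  constructor
  · intro h
    by_contra hcon
    obtain ⟨hu, hv⟩ := not_or.mp hcon
    exact h (by rw [not_not.mp hu, not_not.mp hv, mul_zero, mul_zero, add_zero])
  · rintro h h0
    rcases H h0 with hu | hv
    · rw [hu, mul_zero, zero_add, mul_eq_zero] at h0
      exact h.elim (fun h => h hu) (fun h => h (h0.resolve_left hβ))
    · rw [hv, mul_zero, add_zero, mul_eq_zero] at h0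
      exact h.elim (fun h => h (h0.resolve_left hα)) (fun h => h hv)

/-! ### The shadow of two products in the dead case -/

/-- The face restriction `ρ_a` of `α Π_π U_π + β Π_π V_π` is `α Π_π ρ_a U_π + β Π_π ρ_a V_π`
(`ρ_a` is a `ℂ`-algebra hom). [folklore] -/
theorem restrictFace_twoProd {ι : Type*} [Fintype ι] {D : ℕ} (α β : ℂ)
    (φ ψ : Fin D → (ι → ℂ) × ℂ) (a : ι → Bool) :
    bind₁ (fun l => if a l then (X l : MvPolynomial ι ℂ) else 0)
        (α • ∏ π, affVal (φ π) + β • ∏ π, affVal (ψ π)) =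
      C α * ∏ π, bind₁ (fun l => if a l then (X l : MvPolynomial ι ℂ) else 0) (affVal (φ π)) +
        C β * ∏ π, bind₁ (fun l => if a l then (X l : MvPolynomial ι ℂ) else 0)
          (affVal (ψ π)) := by
  rw [map_add, smul_eq_C_mul, smul_eq_C_mul, map_mul, map_mul, bind₁_C_right, bind₁_C_right,
    map_prod, map_prod]

/-- A product of affine forms survives the face restriction `ρ_a` iff every factor does: its
constant is nonzero or one of its variables with nonzero coefficient has `a j = 1`. [folklore] -/
theorem prod_restrictFace_affVal_ne_zero_iff {ι : Type*} [Fintype ι] {D : ℕ}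
    (φ : Fin D → (ι → ℂ) × ℂ) (a : ι → Bool) :
    ∏ π, bind₁ (fun l => if a l then (X l : MvPolynomial ι ℂ) else 0) (affVal (φ π)) ≠ 0 ↔
      ∀ π, (φ π).2 ≠ 0 ∨ ∃ j, a j = true ∧ (φ π).1 j ≠ 0 := by
  rw [Finset.prod_ne_zero_iff]
  exact ⟨fun h π => (restrictFace_affVal_ne_zero_iff a (φ π)).mp (h π (Finset.mem_univ π)),
    fun h π _ => (restrictFace_affVal_ne_zero_iff a (φ π)).mpr (h π)⟩

/-- **The shadow of two products in the dead case.** Let `g = α Π_π U_π + β Π_π V_π` with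
`α, β ≠ 0` and affine `U_π = affVal (φ π)`, `V_π = affVal (ψ π)` over `ℂ`, and let `a` be a
point such that, if the shadow of `g` is false at `a`, some form dies on the face `a`
(`ρ_a U_π = 0` or `ρ_a V_π = 0`). Then the shadow of `g` at `a` is `B(Π U) a ∨ B(Π V) a`, each
disjunct being the CNF "every factor has nonzero constant or a live variable": over the domain
`ℂ[x]`, `ρ_a g = α Πρ_a U + β Πρ_a V`, and a dead `U_π` forces `β Πρ_a V = ρ_a g = 0`.
[folklore] -/
theorem shadow_twoProd_iff_of_dead {ι : Type*} [Fintype ι] {D : ℕ} {α β : ℂ} (hα : α ≠ 0)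
    (hβ : β ≠ 0) (φ ψ : Fin D → (ι → ℂ) × ℂ) (a : ι → Bool)
    (Ha : (¬ ∃ m ∈ (α • ∏ π, affVal (φ π) + β • ∏ π, affVal (ψ π)).support,
        ∀ i ∈ m.support, a i = true) →
      ∃ π : Fin D,
        bind₁ (fun l => if a l then (X l : MvPolynomial ι ℂ) else 0) (affVal (φ π)) = 0 ∨
          bind₁ (fun l => if a l then (X l : MvPolynomial ι ℂ) else 0) (affVal (ψ π)) = 0) :
    (∃ m ∈ (α • ∏ π, affVal (φ π) + β • ∏ π, affVal (ψ π)).support,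
        ∀ i ∈ m.support, a i = true) ↔
      (∀ π, (φ π).2 ≠ 0 ∨ ∃ j, a j = true ∧ (φ π).1 j ≠ 0) ∨
        ∀ π, (ψ π).2 ≠ 0 ∨ ∃ j, a j = true ∧ (ψ π).1 j ≠ 0 := by
  rw [shadow_iff_restrictFace_ne_zero, restrictFace_twoProd] at Ha ⊢
  rw [add_mul_ne_zero_iff_of_dead (C_ne_zero.mpr hα) (C_ne_zero.mpr hβ) fun h0 =>
      (Ha (not_not_intro h0)).elim fun π hπ => hπ.imp
        (Finset.prod_eq_zero (Finset.mem_univ π)) (Finset.prod_eq_zero (Finset.mem_univ π)),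
    prod_restrictFace_affVal_ne_zero_iff, prod_restrictFace_affVal_ne_zero_iff]

/-! ### Two products cast a shallow shadow in the dead case -/

/-- **Two products of affine forms cast a shallow shadow in the dead case** (abstract form, for
any `decide`-spelling `B` of the shadow): for `g = α Π_{π<D} U_π + β Π_{π<D} V_π` over `ℂ` in
`N = #ι` variables such that every false point of the shadow kills a form,
`formulaSizeOver monotoneBasis B ≤ 16 (D+1)² (N+1)`. If `β = 0` or `α = 0` this is the
one-product bound `4 (D+1) (N+1)` (`formulaSizeOver_shadow_smul_prod_affVal_le`). Otherwise
`B = B(Π U) ∨ B(Π V)` (`shadow_twoProd_iff_of_dead`), an `∨` of two CNFs with `≤ D` clauses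
each; its monotone Karchmer–Wigderson game is solved by "Alice names the true CNF (1 bit), Bob a
violated clause, Alice a live variable of it" (`KWTree.solvesMono_alice_or`, `exists_kwTree_cnf`)
in depth `≤ 1 + ⌈log₂ D⌉ + ⌈log₂ N⌉`, so the size is
`≤ 2 (2D+1) (2N+1) ≤ 16 (D+1)² (N+1)`; a `B` not taking both values has the junk value `0`.
[cite: KarchmerWigderson1990, §2] -/
theorem formulaSizeOver_shadow_twoProd_le_of_dead {ι : Type*} [Fintype ι] {D : ℕ} (α β : ℂ)
    (φ ψ : Fin D → (ι → ℂ) × ℂ)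
    (H : ∀ b : ι → Bool,
      (¬ ∃ m ∈ (α • ∏ π, affVal (φ π) + β • ∏ π, affVal (ψ π)).support,
          ∀ i ∈ m.support, b i = true) →
        ∃ π : Fin D,
          bind₁ (fun l => if b l then (X l : MvPolynomial ι ℂ) else 0) (affVal (φ π)) = 0 ∨
            bind₁ (fun l => if b l then (X l : MvPolynomial ι ℂ) else 0) (affVal (ψ π)) = 0)
    (B : (ι → Bool) → Bool)
    (hB : ∀ a, B a = true ↔ ∃ m ∈ (α • ∏ π, affVal (φ π) + β • ∏ π, affVal (ψ π)).support,
      ∀ i ∈ m.support, a i = true) :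
    formulaSizeOver monotoneBasis B ≤ 16 * (D + 1) ^ 2 * (Fintype.card ι + 1) := by
  classical
  -- the one-product bound is below the two-product bound
  have h4 : 4 * (D + 1) * (Fintype.card ι + 1) ≤ 16 * (D + 1) ^ 2 * (Fintype.card ι + 1) :=
    Nat.mul_le_mul_right _ (Nat.mul_le_mul (by norm_num) (Nat.le_self_pow two_ne_zero _))
  -- `β = 0` or `α = 0`: one scaled product
  by_cases hβ : β = 0
  · have hg : α • ∏ π, affVal (φ π) + β • ∏ π, affVal (ψ π) = α • ∏ π, affVal (φ π) := by
      rw [hβ, zero_smul, add_zero]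
    exact (formulaSizeOver_shadow_smul_prod_affVal_le α φ B fun a => by rw [hB a, hg]).trans h4
  by_cases hα : α = 0
  · have hg : α • ∏ π, affVal (φ π) + β • ∏ π, affVal (ψ π) = β • ∏ π, affVal (ψ π) := by
      rw [hα, zero_smul, zero_add]
    exact (formulaSizeOver_shadow_smul_prod_affVal_le β ψ B fun a => by rw [hB a, hg]).trans h4
  -- `α ≠ 0 ≠ β`: `B = B(Π U) ∨ B(Π V)`, an `∨` of two CNFs
  by_cases hne : (∃ a, B a = true) ∧ ∃ b, B b = false
  · obtain ⟨⟨a₁, ha₁⟩, b₀, hb₀⟩ := hne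
    -- the variable set is nonempty, since `B a₁ ≠ B b₀`
    haveI : Nonempty ι := by
      by_contra hι
      haveI : IsEmpty ι := not_nonempty_iff.mp hι
      rw [Subsingleton.elim a₁ b₀, hb₀] at ha₁
      exact Bool.false_ne_true ha₁
    -- the two CNFs and their protocols
    set BU : (ι → Bool) → Bool := fun a =>
      decide (∀ π, (φ π).2 ≠ 0 ∨ ∃ j, a j = true ∧ (φ π).1 j ≠ 0) with hBU
    set BV : (ι → Bool) → Bool := fun a =>
      decide (∀ π, (ψ π).2 ≠ 0 ∨ ∃ j, a j = true ∧ (ψ π).1 j ≠ 0) with hBV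
    obtain ⟨PU, hPU, hdU⟩ := exists_kwTree_cnf (fun π => (φ π).2 ≠ 0) (fun π j => (φ π).1 j ≠ 0)
      BU fun a => decide_eq_true_iff
    obtain ⟨PV, hPV, hdV⟩ := exists_kwTree_cnf (fun π => (ψ π).2 ≠ 0) (fun π j => (ψ π).1 j ≠ 0)
      BV fun a => decide_eq_true_iff
    -- Alice names the CNF true at `a`, then the CNF protocol
    have hsol := KWTree.solvesMono_alice_or hPU hPV
    have hBeq : B = fun x => BU x || BV x := by
      funext x
      rw [Bool.eq_iff_iff, hB x, shadow_twoProd_iff_of_dead hα hβ φ ψ x (H x), Bool.or_eq_true_iff,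
        hBU, hBV, decide_eq_true_iff, decide_eq_true_iff]
    have hD2 : 2 * D + 1 ≤ 4 * (D + 1) ^ 2 :=
      calc 2 * D + 1 ≤ 4 * (D + 1) := by omega
        _ ≤ 4 * (D + 1) ^ 2 := Nat.mul_le_mul_left _ (Nat.le_self_pow two_ne_zero _)
    rw [hBeq]
    calc formulaSizeOver monotoneBasis (fun x => BU x || BV x)
          ≤ 2 ^ (KWTree.alice BV PU PV).depth := KWTree.formulaSizeOver_le_two_pow_depth _ hsol
      _ ≤ 2 ^ (Nat.clog 2 D + Nat.clog 2 (Fintype.card ι) + 1) := by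
          refine Nat.pow_le_pow_right two_pos ?_
          rw [KWTree.depth_alice]
          exact Nat.succ_le_succ (max_le hdU hdV)
      _ = 2 ^ Nat.clog 2 D * 2 ^ Nat.clog 2 (Fintype.card ι) * 2 := by rw [pow_succ, pow_add]
      _ ≤ (2 * D + 1) * (2 * Fintype.card ι + 1) * 2 :=
          Nat.mul_le_mul_right _
            (Nat.mul_le_mul (RazBlocks.two_pow_clog_le _) (RazBlocks.two_pow_clog_le _))
      _ ≤ 4 * (D + 1) ^ 2 * (2 * (Fintype.card ι + 1)) * 2 :=
          Nat.mul_le_mul_right _ (Nat.mul_le_mul hD2 (by omega))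
      _ = 16 * (D + 1) ^ 2 * (Fintype.card ι + 1) := by ring
  · rw [formulaSizeOver_monotoneBasis_eq_zero_of_not_nonconst hne]
    exact Nat.zero_le _

/-- **Stub `TwoProductDeadCase`** (registered stub `stub_twoProductDeadCase` of line `Sketch`,
crux stmt-ValiantsHypothesis-17124; the `(·, B1)` half of the first bite `T = 2`): if every false
point `b` of the shadow of `g = α Π_π U_π + β Π_π V_π` (two products of `D` affine forms over `ℂ`
in `N = #ι` variables) kills a form on the face `b`, then the monotone formula size of the shadow
is at most `16 (D+1)² (N+1)`: for `αβ = 0` it is one product (a CNF); for `α ≠ 0 ≠ β` every false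
point kills both products, the shadow is `B(Π U) ∨ B(Π V)`, and Alice names the live product, Bob
a dead factor of it, Alice a live variable of that factor. Proof:
`formulaSizeOver_shadow_twoProd_le_of_dead`. [cite: KarchmerWigderson1990, §2] -/
theorem stub_twoProductDeadCase :
    ∀ (ι : Type) [Fintype ι] [DecidableEq ι] (D : ℕ) (α β : ℂ) (φ ψ : Fin D → (ι → ℂ) × ℂ),
      (∀ b : ι → Bool,
        (¬ ∃ m ∈ (α • ∏ π, affVal (φ π) + β • ∏ π, affVal (ψ π)).support, ∀ i ∈ m.support, b i = true) →
        ∃ π : Fin D,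
          MvPolynomial.bind₁ (fun l => if b l then (MvPolynomial.X l : MvPolynomial ι ℂ) else 0)
              (affVal (φ π)) = 0 ∨
          MvPolynomial.bind₁ (fun l => if b l then (MvPolynomial.X l : MvPolynomial ι ℂ) else 0)
              (affVal (ψ π)) = 0) →
      formulaSizeOver monotoneBasis (fun a : ι → Bool =>
          decide (∃ m ∈ (α • ∏ π, affVal (φ π) + β • ∏ π, affVal (ψ π)).support,
            ∀ i ∈ m.support, a i = true)) ≤ 16 * (D + 1) ^ 2 * (Fintype.card ι + 1) :=
  fun _ _ _ _ α β φ ψ H =>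
    formulaSizeOver_shadow_twoProd_le_of_dead α β φ ψ H _ fun _ => decide_eq_true_iff

end Summit.ValiantsHypothesis.ValiantsHypothesis.Theorems.ShallowShadowsShadowFormulaTransfer

end
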